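import Literature.AlgebraicGeometry.Resolution.NodeFittingTrace
import Literature.AlgebraicGeometry.Resolution.AlterationsFormalNodesSingProofs
import Literature.AlgebraicGeometry.Resolution.AlterationsNodeLocalStructureProofs
import Literature.AlgebraicGeometry.Resolution.AlterationsSingularComponentsGlue
import HarnessLib

/-!
# De Jong 1996, 2.23 with its Remark and 3.3: `DeJong1996SplitNodalStructureSing_holds`

Topic: `Literature/AlgebraicGeometry/Resolution`. Discharge of the named fact
`DeJong1996SplitNodalStructureSing` of `AlterationsFormalNodesSing.lean` (de Jong 1996, 2.23
WITH its Remark — "in this case (i.e. `h ∈ A'`) the trace of `Sing(f)` on the scheme `Spec B` is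
given by the ideal `(u, v) ⊂ B`" (p. 62) — and 3.3 in the split case, at a closed point of
`Sing(f)` of the curve of a pair in Situation 4.23 over an algebraically closed field). The
tree had reduced it (`DeJong1996SplitNodalStructureSing.of_nodeLocalStructure_of_singTrace`,
`AlterationsFormalNodesSingProofs.lean`) to

* the node local structure 2.23/3.3 (`DeJong1996NodeLocalStructure`) — PROVED,
  `DeJong1996NodeLocalStructure_holds` (`AlterationsNodeLocalStructureProofs.lean`);
* the Remark of 2.23 for the structure isomorphisms `e : 𝒪̂_{X,x} ≅ Â⟦u, v⟧/(uv - h)` over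
  `Â = 𝒪̂_{Y,f x}`: `e` carries `Fitt₁(Ω_{X/Y})_x 𝒪̂_{X,x}` onto `(u, v)` — PROVED here
  (`DeJong1996.SemiStablePair.map_singFittingIdeal_eq_span`) from the algebra of
  `NodeFittingTrace.lean` (`DeJong1996.NodeDeformationRing.map_fittingIdeal_eq_span`), whose
  hypotheses hold at a closed point of the curve of a pair: `𝒪_{Y,f x} → 𝒪_{X,x}` is a local
  homomorphism of Noetherian local rings essentially of finite type, and both residue fields are
  the ground field (`exists_stalkMap_sub_mem_maximalIdeal`,
  `AlterationsSingularComponentsGlue.lean`).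

Everything is PROVED; no definition, no named fact.

## Sources

* A. J. de Jong, *Smoothness, semi-stability and alterations*, Publ. Math. IHÉS 83 (1996) 51–93:
  2.21, 2.23 with its Remark (pp. 61–62), 3.3 (p. 63), 4.24 (p. 75). [DeJong1996]
-/

noncomputable section

open CategoryTheory CategoryTheory.Limits AlgebraicGeometry TopologicalSpace IsLocalRing

namespace Literature.AlgebraicGeometry.Resolution

universe u

namespace DeJong1996.SemiStablePair

open NodalDeformation

variable {k : Type u} [Field k] {X Y : Scheme.{u}} {f : X ⟶ Y} {g : Y ⟶ Spec (.of k)}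
  {D : Set Y} {n : ℕ} {τ : Fin n → (Y ⟶ X)}

/-- **de Jong 1996, 2.23, Remark, at a closed point of `Sing(f)` of a pair: "the trace of
`Sing(f)` on the scheme `Spec B` is given by the ideal `(u, v) ⊂ B`."** For the curve `f : X → Y`
of a pair in Situation 4.23 over an algebraically closed field, a closed point `x` at which `f`
is not smooth, and ANY ring isomorphism `e : 𝒪̂_{X,x} ≅ 𝒪̂_{Y,f x}⟦u, v⟧/(uv - h)` compatible with
the completed stalk map, `e` carries the extension to `𝒪̂_{X,x}` of the stalk
`Fitt₁(Ω_{X/Y})_x` (`Scheme.Hom.singFittingIdeal f x`) onto `(u, v)`. This is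
`DeJong1996.NodeDeformationRing.map_fittingIdeal_eq_span` at the local rings of `x` and `f x`
(Noetherian, `f^#_x` local and essentially of finite type, residue fields `k = k̄` on both
sides). [cite: DeJong1996, 2.23 Remark, p. 62] -/
theorem map_singFittingIdeal_eq_span [IsAlgClosed k] (hS : SemiStablePair f g D τ) {x : X}
    (hx : IsClosed ({x} : Set X))
    (h : Cpl (Y.presheaf.stalk (f x)))
    (e : Cpl (X.presheaf.stalk x) ≃+* NodeDeformationRing _ h)
    (he : e.toRingHom.comp (completedStalkMap f x) = NodeDeformationRing.ofBase _ _) :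
    ((Scheme.Hom.singFittingIdeal f x).map
        (algebraMap (X.presheaf.stalk x) (Cpl (X.presheaf.stalk x)))).map e.toRingHom =
      Ideal.span {Ideal.Quotient.mk _ (MvPowerSeries.X 0),
        Ideal.Quotient.mk _ (MvPowerSeries.X 1)} := by
  classical
  haveI := hS.isIntegral
  haveI := hS.locallyOfFiniteType
  haveI := hS.isNoetherian
  haveI := hS.isNoetherian_base
  haveI := hS.isSemiStableCurve.isProper
  haveI := hS.isSemiStableCurve.locallyOfFiniteType
  haveI : IsProper g :=
    Literature.AlgebraicGeometry.Motives.IsProjectiveOver.isProper (X := Over.mk g)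
      hS.isProjectiveOver_base
  letI algAB : Algebra (Y.presheaf.stalk (f x)) (X.presheaf.stalk x) := (f.stalkMap x).hom.toAlgebra
  haveI : IsLocalHom (algebraMap (Y.presheaf.stalk (f x)) (X.presheaf.stalk x)) :=
    inferInstanceAs (IsLocalHom (f.stalkMap x).hom)
  haveI : Algebra.EssFiniteType (Y.presheaf.stalk (f x)) (X.presheaf.stalk x) :=
    LocallyOfFiniteType.stalkMap f x
  have hy : IsClosed ({f x} : Set Y) := by
    rw [← Set.image_singleton]
    exact f.isClosedMap _ hx
  -- both residue fields are `k`: every germ at `x` is a germ at `f x` plus an element of `𝔪ₓ`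
  have hres : ∀ b : X.presheaf.stalk x, ∃ a : Y.presheaf.stalk (f x),
      b - algebraMap (Y.presheaf.stalk (f x)) (X.presheaf.stalk x) a ∈
        maximalIdeal (X.presheaf.stalk x) := by
    intro b
    obtain ⟨a, ha⟩ := exists_stalkMap_sub_mem_maximalIdeal f g hx hy b
    refine ⟨a, ?_⟩
    rw [← neg_sub]
    exact Submodule.neg_mem _ ha
  -- `A = 𝒪_{Y,f x}` acts through the constants under `e`
  have hΨ : ∀ a : Y.presheaf.stalk (f x),
      e (algebraMap (X.presheaf.stalk x) (Cpl (X.presheaf.stalk x))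
        (algebraMap (Y.presheaf.stalk (f x)) (X.presheaf.stalk x) a)) =
      Ideal.Quotient.mk _ (MvPowerSeries.C
        (algebraMap (Y.presheaf.stalk (f x)) (Cpl (Y.presheaf.stalk (f x))) a)) := by
    intro a
    have h1 := DFunLike.congr_fun he (AdicCompletion.of _ _ a)
    rw [RingHom.comp_apply, NodeDeformationRing.ofBase_apply, completedStalkMap_of] at h1
    exact h1
  exact NodeDeformationRing.map_fittingIdeal_eq_span hres e hΨ

end DeJong1996.SemiStablePair

/-- **de Jong 1996, 2.23 with its Remark and 3.3, split case (`DeJong1996SplitNodalStructureSing`)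
— PROVED**: the node local structure 2.23/3.3 (`DeJong1996NodeLocalStructure_holds`) and the
Remark of 2.23 (`DeJong1996.SemiStablePair.map_singFittingIdeal_eq_span`), assembled by
`DeJong1996SplitNodalStructureSing.of_nodeLocalStructure_of_singTrace`.
[cite: DeJong1996, 2.23 with Remark and 3.3, pp. 61–63] -/
theorem DeJong1996SplitNodalStructureSing_holds : DeJong1996SplitNodalStructureSing.{u} :=
  DeJong1996SplitNodalStructureSing.of_nodeLocalStructure_of_singTrace
    DeJong1996NodeLocalStructure_holds
    (fun _ _ _ _ _ _ _ _ _ _ hS _ hx _ h e he => hS.map_singFittingIdeal_eq_span hx h e he)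

end Literature.AlgebraicGeometry.Resolution

end
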